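import Summits.BirchSwinnertonDyer.Rank1Residual.X11b.Three.KolyvaginShaOrderThreeOfProp37
import Summits.BirchSwinnertonDyer.Rank1Residual.X11b.Three.KolyvaginShaThreeOfGross1991
import HarnessLib

/-!
# Kolyvagin's ORDER bound `ord_3 #Ш(E/K)[3^∞] ≤ 2 · ord_3 [E(K) : ℤ y_K]` on the class X11b @ 3 with
# `ρ̄_{E,3}` onto — NO Kodaira–Néron sub-class (KN₃) — modulo TWO NAMED facts (Gross 1991 Prop. 3.7 (2)
# and §6 / [GZ86, III (3.1)] BY NAME) and the Cassels–Tate inputs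

Cell `b2b-bsdres`, team x11b3 (N8/O2 = X11b @ 3); seat x11b3-p2 GEN 54 (unit claimed D-0075 →
BSD:K2/P4 «Kolyvagin-in-kernel»; the ladder-P4/P5 ORDER form at `p = 3`).  Summit-side THEOREM-ONLY
file (no definition, no named fact, no `sorry`); `K : Type`; the literal prime `3`.

HONEST FRAMING (cell `b2b-bsdres`, run/shared/lean/b2b/bsd-rank1-residual/, verbatim in every
file): the goal of the cell is to DELETE the COMBINATION-SHAPED residual classes of the
Birch–Swinnerton-Dyer formula for ALL analytic-rank `≤ 1` elliptic curves over `ℚ` — "full BSD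
formula for every rank `≤ 1` curve in class `C`" assembled STRICTLY from published theorems — so
that the rank-`≤ 1` remainder becomes exactly the CONSTRUCTION-SHAPED classes, which are TYPED
(missing-input `Prop`s), NOT attempted.  This is not "finishing BSD".  Nothing here is booked; no
mark / label / count / tier moves; X11b @ 3 = O2/B10 stays OPEN / CONSTRUCTION-SHAPED (Kolyvagin
bounds `Ш` relative to the Heegner index; it is ONE inequality of clause (iii), not `BSD_3`).

WHAT THIS FILE DOES.  The `p = 3` ORDER forms of record (`X11b/Three/KolyvaginShaOrderThreeOfProp37`,
x11b3-p2 GEN 53: `Ш(E/K)[3^∞]` finite ∧ `3^{M₀}`-torsion ∧ `#Ш(E/K)[3^∞] ≤ 3^{2M₀}` ∧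
`ord_3 # ≤ 2M₀`, and the Heegner-INDEX form `M₀ = ord_3 [E(K) : ℤ y_K]`, modulo the NAMED fact
`GrossLMS1991.prop37_2_reductionCongruence N W K 3` and the displayed Cassels–Tate inputs) live on
ClassX11b W 3 ∩ (KN₃)/ℚ, where (KN₃) SUPPLIED the receptacle binder `hGZ` ([GZ86, III (3.1)]) by
Kodaira–Néron AND made `ρ̄_{E,3}` onto.  THIS FILE removes (KN₃) exactly as
`X11b/Three/KolyvaginShaThreeOfGross1991` (this GEN) does for the finiteness / annihilator ENDs:
`hGZ` is the NAMED Literature fact `Gross1991_heegnerPoint_sub_ratTorsion_mem_E0` read into the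
x11b3 binder (`hGZ_endBinder_three_of_classX11b_of_surj`), `ρ̄_{E,3}` onto is the class atom
`Surj W 3` as an HYPOTHESIS, and the two ENDs are re-derived from the hGZ-hypothesis parent
`Three.KolyvaginOrder.card_sha_three_primary_le_of_leafInputs_of_poitouTate_of_localDuality`
(x11b3 (P2-QUANT) PART D+) with `hPT`, `hrec`, `hCM`, `h53` discharged by the tree theorems; the
INDEX form re-runs the tree's McCallum-Lemma-5.1 step (`Additive.zsmul_certificate_of_padicValNat_index`,
`E(K)[3] = 0` from `Surj W 3` by `torsionBy_eq_bot_of_isImaginaryQuadratic`; the case `M₀ = 0` is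
this GEN's `sha_three_primary_eq_zero_of_classX11b_of_surj_of_gross1991E0_of_not_dvd_of_prop37`).
Binders `hKN3m` / `hKN3a` REPLACED by `hS` + `hE0`; every other binder (incl. the Cassels–Tate
inputs) and the conclusions VERBATIM the GEN 53 ones.  Net (honest): for EVERY `(E, 3) ∈ ClassX11b
W 3` with `Surj W 3`, at `N = N_E`, any imaginary quadratic Heegner `K` with a non-torsion Heegner
point `y_K` of finite index: `ord_3 #Ш(E/K)[3^∞] ≤ 2 · ord_3 [E(K) : ℤ y_K]` — the printed shape of
McCallum 1991 §1 Theorem (Kolyvagin) / the named fact `Kolyvagin1990_padicValNat_card_sha_le` at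
`p = 3` for the `3`-primary part — CONDITIONAL on the two NAMED PUBLISHED facts + the Cassels–Tate
inputs, with NO condition on Tamagawa numbers or Kodaira types.  Neither fact is discharged; the
Cassels–Tate inputs are displayed hypotheses, not facts; nothing booked; no mark / count / tier moves.

## What is proved (namespace `Summit.BirchSwinnertonDyer.Rank1Residual.X11b.Three.KolyvaginDischarged`)

* `card_sha_three_primary_le_of_classX11b_of_surj_of_gross1991E0_of_localDuality_of_prop37` — the
  `M₀ ≥ 1` form with `3^{M₀} x₀ = y_K ∉ 3^{M₀+1} E(K)`.
* `card_sha_three_primary_le_of_classX11b_of_surj_of_gross1991E0_index_of_localDuality_of_prop37` —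
  the Heegner-INDEX form `M₀ = ord_3 [E(K) : ℤ y_K]`.

## References

* [McCallumLMS1991] W. G. McCallum, LMS LNS 153 (1991), §1 Theorem (Kolyvagin), Lemma 5.1 (p. 303),
  Thm. 5.4, Cor. 5.6.  [GrossLMS1991] §2 Prop. 2.1 (2), Thm. 2.2 (2), §3 Prop. 3.7 (2) (p. 240),
  §6 Prop. 6.2 (1) and its proof (p. 245).  [GrossZagier1986Heegner] III (3.1) (p. 256).
* [MilneADT2006] Ch. I §6, Thm. 6.13 (a).  [SilvermanATAEC1994] Thm. II.6.4.

presearch: `lean search 'of_surj_of_gross1991E0'` → this GEN's files only; parents = the tree ENDs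
named above; [corpus: book:editornd-l-functions-arithmetic p0222:L1, p0217:L19–L22, p0281 (McCallum
Lemma 5.1)]; nothing minted.
-/

noncomputable section

namespace Summit.BirchSwinnertonDyer.Rank1Residual.X11b.Three.KolyvaginDischarged

open scoped Classical
open WeierstrassCurve Field NumberField IsDedekindDomain Function
open Literature.NumberTheory.EllipticCurves Literature.NumberTheory.GaloisRepresentations
open Literature.NumberTheory.EllipticCurves.Rank1Residual
open Literature.NumberTheory.EllipticCurves.RingClassField
open Literature.NumberTheory.EllipticCurves.ModularForms
open Literature.NumberTheory.DiophantineGeometry Literature.NumberTheory.DiophantineGeometry.TateAlgorithm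
open Literature.NumberTheory.GaloisCohomology
open Literature.NumberTheory.GaloisRepresentations.DiscreteGaloisModule (mu MuCarrier)
open Literature.NumberTheory.EllipticCurves.GrossLMS1991 (prop37_2_reductionCongruence)

-- `LocallyCompactSpace Γ_K` / `CharZero` of completions, as in the tree's Cassels–Tate files.
attribute [local instance] absoluteGaloisGroup_compactSpace charZero_placeCompletion

variable {K : Type} [Field K] [NumberField K] {N : ℕ} {W : WeierstrassCurve ℚ}

/-- **On the class X11b @ 3 with `ρ̄_{E,3}` onto: `ord_3 #Ш(E/K)[3^∞] ≤ 2M₀` — NO Kodaira–Néron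
hypothesis — modulo the TWO NAMED facts `GrossLMS1991.prop37_2_reductionCongruence N W K 3` and
`Gross1991_heegnerPoint_sub_ratTorsion_mem_E0` and the Cassels–Tate inputs, no inline cite-only
input** — for `3^{M₀} x₀ = y_K ∉ 3^{M₀+1}E(K)`, `M₀ ≥ 1`: `Ш(E/K)[3^∞]` finite, killed by `3^{M₀}`,
of order `≤ 3^{2M₀}`.  The hGZ-hypothesis parent
`Three.KolyvaginOrder.card_sha_three_primary_le_of_leafInputs_of_poitouTate_of_localDuality` with
`hPT`, `hrec`, `hCM`, `h53` SUPPLIED by the tree theorems and `hGZ`, `hγ` by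
`hGZ_endBinder_three_of_classX11b_of_surj` / `prop37_endBinder_three_of_classX11b_of_surj`; binders
`hKN3m` / `hKN3a` of the (KN₃)/ℚ twin REPLACED by `hS` + `hE0`, every other binder (incl. the
displayed Cassels–Tate inputs) and the conclusion VERBATIM.  CONDITIONAL on EXACTLY the two named
facts (PUBLISHED, NOT discharged) + `hN` + `hS` + the Cassels–Tate inputs; nothing booked; no mark /
count / tier moves. [cite: McCallumLMS1991, §1 Theorem (Kolyvagin), Cor. 5.6]
[cite: GrossLMS1991, Thm. 2.2 (2), §3 Prop. 3.7 (2) (p. 240), §6 Prop. 6.2 (1) (p. 245)]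
[cite: GrossZagier1986Heegner, III (3.1) Proposition, p. 256] [cite: MilneADT2006, Ch. I §6, Thm. 6.13(a)] -/
theorem card_sha_three_primary_le_of_classX11b_of_surj_of_gross1991E0_of_localDuality_of_prop37 [NeZero N]
    [W.IsGloballyMinimal] (hW : ClassX11b W 3) (hS : Surj W 3)
    (hN : ∀ [W.IsElliptic], N = W.conductorNorm ℤ)
    (hE0 : Gross1991_heegnerPoint_sub_ratTorsion_mem_E0)
    (hγ : prop37_2_reductionCongruence N W K 3) :
    ∀ [W.IsElliptic] (_hK : IsImaginaryQuadratic K) (_hH : SatisfiesHeegnerHypothesis N K)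
      {P : (W.baseChange K).toAffine.Point} (_hP : IsHeegnerPoint N W K P)
      (_hnt : ¬ IsOfFinAddOrder P)
      {M₀ : ℕ} (_hM₀ : 1 ≤ M₀) [NeZero (3 ^ M₀)] {c : K ≃ₐ[ℚ] K} (_hc : c ≠ 1) (_hcc : c * c = 1)
      {x₀ : (W.baseChange K).toAffine.Point} (_hx₀ : 3 ^ M₀ • x₀ = P)
      (_hmax : ∀ Q : (W.baseChange K).toAffine.Point, 3 ^ (M₀ + 1) • Q ≠ P)
      (e : geomTorsion (W.baseChange K) ((3 ^ M₀ * 3 ^ M₀ : ℕ) : ℤ) →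
        geomTorsion (W.baseChange K) ((3 ^ M₀ * 3 ^ M₀ : ℕ) : ℤ) → AlgebraicClosure K)
      (hμ : ∀ S T, e S T ^ (3 ^ M₀ * 3 ^ M₀) = 1)
      (hadd₁ : ∀ S₁ S₂ T, e (S₁ + S₂) T = e S₁ T * e S₂ T)
      (hadd₂ : ∀ S T₁ T₂, e S (T₁ + T₂) = e S T₁ * e S T₂)
      (hgal : ∀ (σ : absoluteGaloisGroup K) (S T : geomTorsion (W.baseChange K) ((3 ^ M₀ * 3 ^ M₀ : ℕ) : ℤ)),
        σ • e S T = e (σ • S) (σ • T))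
      (halt : ∀ T, e T T = 1) (hnondeg : ∀ T, (∀ S, e S T = 1) → T = 0)
      (inv : LocalInvariants K (3 ^ M₀ * 3 ^ M₀)) (hPT' : inv.SumInvLocalizationEqZero)
      (hinv : ∀ v : HeightOneSpectrum (𝓞 K), Injective (inv (Sum.inr v)))
      (hH3 : ∀ x : galoisCohomology (mu K (3 ^ M₀ * 3 ^ M₀)) 3,
        (∀ v : Place K, galoisCohomology.localization (mu K (3 ^ M₀ * 3 ^ M₀)) v 3 x = 0) → x = 0)
      (hB : Literature.GroupTheory.FiniteAbelian.IsLevelPairing (3 ^ M₀)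
        (ctLevelPairing (W.baseChange K) (3 ^ M₀) e hμ hadd₁ hadd₂ hgal inv halt hPT' hH3
          (localTerm_finite_support (W := W.baseChange K) (m := 3 ^ M₀) (e := e) (hμ := hμ)
            (hadd₁ := hadd₁) (hadd₂ := hadd₂) (hgal := hgal) halt inv)))
      (hPτ : ∀ z ∈ selmerGroup (W.baseChange K) ((3 ^ M₀ * 3 ^ M₀ : ℕ) : ℤ),
        ∀ t ∈ selmerGroup (W.baseChange K) ((3 ^ M₀ * 3 ^ M₀ : ℕ) : ℤ),
        ctGeneralFun (W.baseChange K) (3 ^ M₀) e hμ hadd₁ hadd₂ hgal inv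
            (torsionH1ToH1 (W.baseChange K) _ (conjAct W c _ z))
            (torsionH1ToH1 (W.baseChange K) _ (conjAct W c _ t)) =
          ctGeneralFun (W.baseChange K) (3 ^ M₀) e hμ hadd₁ hadd₂ hgal inv
            (torsionH1ToH1 (W.baseChange K) _ z) (torsionH1ToH1 (W.baseChange K) _ t)),
      Finite (AddCommGroup.primaryComponent (W.baseChange K).sha 3) ∧
      (∀ c ∈ AddCommGroup.primaryComponent (W.baseChange K).sha 3, 3 ^ M₀ • c = 0) ∧
      Nat.card (AddCommGroup.primaryComponent (W.baseChange K).sha 3) ≤ 3 ^ (2 * M₀) ∧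
      padicValNat 3 (Nat.card (AddCommGroup.primaryComponent (W.baseChange K).sha 3)) ≤ 2 * M₀ := by
  intro _ hK hH P hP hnt M₀ hM₀ _ c hc hcc x₀ hx₀ hmax e hμ hadd₁ hadd₂ hgal halt hnondeg inv hPT' hinv hH3
    hB hPτ
  exact Three.KolyvaginOrder.card_sha_three_primary_le_of_leafInputs_of_poitouTate_of_localDuality
    (poitouTate_sum_localTatePairing_eq_zero_holds K) hN hW.2.2.1
    (heegnerPointOfConductor_one_galoisConj_holds N W K) (KolyvaginLeaves.hCM_holds N W K 3)
    (@fun _ ↦ KolyvaginLeaves.h53_holds hN 3)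
    (@fun _ ↦ hGZ_endBinder_three_of_classX11b_of_surj hE0 hW hS hN)
    (@fun _ ↦ prop37_endBinder_three_of_classX11b_of_surj hW hS hN hγ) hK hH hP hnt hS hM₀ hc hcc hx₀
    hmax e hμ hadd₁ hadd₂ hgal halt hnondeg inv hPT' hinv hH3 hB hPτ

/-- **McCallum 1991 §1 Theorem (Kolyvagin) at `p = 3` on the class X11b @ 3 with `ρ̄_{E,3}` onto, in
the printed Heegner-INDEX form: `ord_3 #Ш(E/K)[3^∞] ≤ 2 · ord_3 [E(K) : ℤ y_K]`** (for `[E(K) : ℤ y_K]`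
finite, `_hidx`; the index is Mathlib's `AddSubgroup.index`), together with: `Ш(E/K)[3^∞]` finite,
killed by `3^{M₀}`, of order `≤ 3^{2M₀}`, `M₀ = ord_3 [E(K) : ℤ y_K]` — NO Kodaira–Néron hypothesis.
McCallum's Lemma 5.1 (`M₀ = max{M : y_K ∈ 3^M E(K)}`, tree `Additive.zsmul_certificate_of_padicValNat_index`,
using `E(K)[3] = 0` from `Surj W 3`, `torsionBy_eq_bot_of_isImaginaryQuadratic`) converts the index
into `3^{M₀} x₀ = y_K ∉ 3^{M₀+1}E(K)`; `M₀ ≥ 1` is the previous theorem, `M₀ = 0` is `Ш(E/K)[3^∞] = 0`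
(Gross Prop. 2.1 (2); this GEN's `sha_three_primary_eq_zero_of_classX11b_of_surj_of_gross1991E0_of_not_dvd_of_prop37`).
This is the shape of the named fact `Kolyvagin1990_padicValNat_card_sha_le` at the prime `3` for the
`3`-primary part, MODULO the two NAMED facts + `hN` + `hS` + the Cassels–Tate inputs — NOT that fact,
which is neither used nor discharged; nothing booked; no mark / count / tier moves.
[cite: McCallumLMS1991, §1 Theorem (Kolyvagin), Lemma 5.1 (p. 303), Cor. 5.6]
[cite: GrossLMS1991, §2 Prop. 2.1 (2), Thm. 2.2 (2), §3 Prop. 3.7 (2), §6 Prop. 6.2 (1)]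
[cite: MilneADT2006, Ch. I §6, Thm. 6.13(a)] -/
theorem card_sha_three_primary_le_of_classX11b_of_surj_of_gross1991E0_index_of_localDuality_of_prop37 [NeZero N]
    [W.IsGloballyMinimal] (hW : ClassX11b W 3) (hS : Surj W 3)
    (hN : ∀ [W.IsElliptic], N = W.conductorNorm ℤ)
    (hE0 : Gross1991_heegnerPoint_sub_ratTorsion_mem_E0)
    (hγ : prop37_2_reductionCongruence N W K 3) :
    ∀ [W.IsElliptic] (_hK : IsImaginaryQuadratic K) (_hH : SatisfiesHeegnerHypothesis N K)
      {P : (W.baseChange K).toAffine.Point} (_hP : IsHeegnerPoint N W K P)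
      (_hnt : ¬ IsOfFinAddOrder P) (_hidx : (AddSubgroup.zmultiples P).index ≠ 0)
      {M₀ : ℕ} (_hv : padicValNat 3 (AddSubgroup.zmultiples P).index = M₀) [NeZero (3 ^ M₀)]
      {c : K ≃ₐ[ℚ] K} (_hc : c ≠ 1) (_hcc : c * c = 1)
      (e : geomTorsion (W.baseChange K) ((3 ^ M₀ * 3 ^ M₀ : ℕ) : ℤ) →
        geomTorsion (W.baseChange K) ((3 ^ M₀ * 3 ^ M₀ : ℕ) : ℤ) → AlgebraicClosure K)
      (hμ : ∀ S T, e S T ^ (3 ^ M₀ * 3 ^ M₀) = 1)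
      (hadd₁ : ∀ S₁ S₂ T, e (S₁ + S₂) T = e S₁ T * e S₂ T)
      (hadd₂ : ∀ S T₁ T₂, e S (T₁ + T₂) = e S T₁ * e S T₂)
      (hgal : ∀ (σ : absoluteGaloisGroup K) (S T : geomTorsion (W.baseChange K) ((3 ^ M₀ * 3 ^ M₀ : ℕ) : ℤ)),
        σ • e S T = e (σ • S) (σ • T))
      (halt : ∀ T, e T T = 1) (hnondeg : ∀ T, (∀ S, e S T = 1) → T = 0)
      (inv : LocalInvariants K (3 ^ M₀ * 3 ^ M₀)) (hPT' : inv.SumInvLocalizationEqZero)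
      (hinv : ∀ v : HeightOneSpectrum (𝓞 K), Injective (inv (Sum.inr v)))
      (hH3 : ∀ x : galoisCohomology (mu K (3 ^ M₀ * 3 ^ M₀)) 3,
        (∀ v : Place K, galoisCohomology.localization (mu K (3 ^ M₀ * 3 ^ M₀)) v 3 x = 0) → x = 0)
      (hB : Literature.GroupTheory.FiniteAbelian.IsLevelPairing (3 ^ M₀)
        (ctLevelPairing (W.baseChange K) (3 ^ M₀) e hμ hadd₁ hadd₂ hgal inv halt hPT' hH3
          (localTerm_finite_support (W := W.baseChange K) (m := 3 ^ M₀) (e := e) (hμ := hμ)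
            (hadd₁ := hadd₁) (hadd₂ := hadd₂) (hgal := hgal) halt inv)))
      (hPτ : ∀ z ∈ selmerGroup (W.baseChange K) ((3 ^ M₀ * 3 ^ M₀ : ℕ) : ℤ),
        ∀ t ∈ selmerGroup (W.baseChange K) ((3 ^ M₀ * 3 ^ M₀ : ℕ) : ℤ),
        ctGeneralFun (W.baseChange K) (3 ^ M₀) e hμ hadd₁ hadd₂ hgal inv
            (torsionH1ToH1 (W.baseChange K) _ (conjAct W c _ z))
            (torsionH1ToH1 (W.baseChange K) _ (conjAct W c _ t)) =
          ctGeneralFun (W.baseChange K) (3 ^ M₀) e hμ hadd₁ hadd₂ hgal inv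
            (torsionH1ToH1 (W.baseChange K) _ z) (torsionH1ToH1 (W.baseChange K) _ t)),
      Finite (AddCommGroup.primaryComponent (W.baseChange K).sha 3) ∧
      (∀ c ∈ AddCommGroup.primaryComponent (W.baseChange K).sha 3, 3 ^ M₀ • c = 0) ∧
      Nat.card (AddCommGroup.primaryComponent (W.baseChange K).sha 3) ≤ 3 ^ (2 * M₀) ∧
      padicValNat 3 (Nat.card (AddCommGroup.primaryComponent (W.baseChange K).sha 3)) ≤ 2 * M₀ := by
  intro _ hK hH P hP hnt hidx M₀ hv _ c hc hcc e hμ hadd₁ hadd₂ hgal halt hnondeg inv hPT' hinv hH3 hB hPτ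
  haveI : (W.baseChange K).IsElliptic := inferInstanceAs (W.map (algebraMap ℚ K)).IsElliptic
  -- `E(K)[3] = 0` (`ρ̄_{E,3}` onto = `hS`)
  have hbot := torsionBy_eq_bot_of_isImaginaryQuadratic W K hK Nat.prime_three (by decide) hS
  have hA : ∀ a : (W.baseChange K).toAffine.Point, ((3 : ℕ) : ℤ) • a = 0 → a = 0 := fun a ha ↦ by
    have : a ∈ AddSubgroup.torsionBy (W.baseChange K).toAffine.Point ((3 : ℕ) : ℤ) := by
      rw [mem_torsionBy_iff]; exact ha
    rw [hbot] at this
    exact this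
  -- McCallum Lemma 5.1: `ord_3 [E(K) : ℤ y_K] = M₀ ⟺ 3^{M₀} ∥ y_K`
  obtain ⟨⟨x₀, hx₀⟩, hmax'⟩ :=
    Additive.zsmul_certificate_of_padicValNat_index Nat.prime_three hA hnt hidx hv
  have hx₀' : 3 ^ M₀ • x₀ = P := by rw [← natCast_zsmul]; exact hx₀
  have hmax : ∀ Q : (W.baseChange K).toAffine.Point, 3 ^ (M₀ + 1) • Q ≠ P := fun Q hQ ↦
    hmax' ⟨Q, by rw [natCast_zsmul]; exact hQ⟩
  rcases Nat.eq_zero_or_pos M₀ with h0 | hpos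
  · -- `3 ∤ y_K`: `Ш(E/K)[3^∞] = 0` (Gross Prop. 2.1 (2))
    subst h0
    have hzero := sha_three_primary_eq_zero_of_classX11b_of_surj_of_gross1991E0_of_not_dvd_of_prop37 hW
      hS hN hE0 hγ hK hH hP hnt (fun Q ↦ by simpa using hmax Q)
    have hz : ∀ c ∈ AddCommGroup.primaryComponent (W.baseChange K).sha 3, c = 0 := fun c hc ↦
      hzero c (AddCommGroup.mem_primaryComponent.mp hc)
    haveI : Subsingleton (AddCommGroup.primaryComponent (W.baseChange K).sha 3) :=
      ⟨fun a b ↦ Subtype.ext ((hz a.1 a.2).trans (hz b.1 b.2).symm)⟩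
    have hcard : Nat.card (AddCommGroup.primaryComponent (W.baseChange K).sha 3) = 1 :=
      Nat.card_eq_one_iff_unique.mpr ⟨inferInstance, ⟨0⟩⟩
    refine ⟨Finite.of_subsingleton, fun c hc ↦ ?_, by rw [hcard]; simp, by rw [hcard]; simp⟩
    rw [hz c hc, smul_zero]
  · exact card_sha_three_primary_le_of_classX11b_of_surj_of_gross1991E0_of_localDuality_of_prop37 hW
      hS hN hE0 hγ hK hH hP hnt hpos hc hcc hx₀' hmax e hμ hadd₁ hadd₂ hgal halt hnondeg inv hPT' hinv
      hH3 hB hPτ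

end Summit.BirchSwinnertonDyer.Rank1Residual.X11b.Three.KolyvaginDischarged

end
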